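import Summits.CriticalPhenomena.CardyFormulaZ2.Theorems.CardyWhiteToColouredNoiseDiscretisationCrossingWalk
import Summits.CriticalPhenomena.CardyFormulaZ2.Theorems.CardyWhiteToColouredNoiseDiscretisationLatticeApprox

/-!
# Crossings of `R̄` by super-level sets of a continuous field (part 4): stability

Helper file for item `NoiseDiscretisation` (stmt-CriticalPhenomena-4598) of route
`CardyWhiteToColoured` (`CardyFormulaZ2`).

`crossing_stability`: let `R` be a conformal rectangle and `F` a continuous field which is
*robust* — either `R̄` is crossed at level `0` (`PosCross[R, F, 0]`), or for some `c > 0` it is not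
even crossed at level `−c`. Then there are `η > 0` and `δ₁ > 0` such that for every mesh
`0 < δ < δ₁` and every edge function `g` which is `η`-close to `F` at the medial points of the inner
edges, the positive configuration `PosCfg[g]` realises Smirnov's discrete crossing event
`discreteCrossing Ω δ (arc 0) (arc 2)` **iff** `PosCross[R, F, 0]`. This combines the two
directions `discreteCrossing_of_posCross` (part 3) and `posCrossing_of_discreteCrossing` (part 2)
with the margin lemma `exists_lt_posCross` (part 1). Almost every sample of a smoothed white noise
is robust (no atom of the maximin functional), which is proved elsewhere.

References: V. Beffara, D. Gayet, Publ. IHÉS 126 (2017), §1; S. Smirnov, C. R. Acad. Sci. Paris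
333 (2001), §2.
-/

noncomputable section

namespace Summit.CriticalPhenomena.CardyFormulaZ2.Theorems

namespace WhiteToColoured

open Set Metric Filter Topology
open Literature.Probability.LatticeModels Literature.Probability.Percolation
open Literature.Probability.RandomPlanarGeometry

/-- `PosCross[R, F, c]`: some path in `closure R.carrier` from `arc 0` to `arc 2` has `F > c`. -/
local notation3 "PosCross[" R ", " F ", " c "]" =>
  ∃ x ∈ MarkedDomain.arc R (0 : Fin 4), ∃ y ∈ MarkedDomain.arc R (2 : Fin 4), ∃ γ : Path x y,
    ∀ t, γ t ∈ closure (JordanDomain.carrier (MarkedDomain.toJordanDomain R)) ∧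
      (c : ℝ) < (F : ℂ → ℝ) (γ t)

/-- `InnerE[Ω, δ]`: the inner lattice edges at mesh `δ` (both mesh end-points in `Ω`). -/
local notation3 "InnerE[" Ω ", " δ "]" =>
  {e : Sym2 (Site 2) | e ∈ (zdGraph 2).edgeSet ∧ ∀ v ∈ e, meshPoint δ v ∈ (Ω : Set ℂ)}

/-- `PosCfg[g]`: the bond configuration of positive values of the edge function `g`. -/
local notation3 "PosCfg[" g "]" =>
  {e : Sym2 (Site 2) | e ∈ (zdGraph 2).edgeSet ∧ (0 : ℝ) < (g : Sym2 (Site 2) → ℝ) e}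

/-- **Stability of the crossing event for robust continuous fields.** See the module docstring. -/
theorem crossing_stability (R : ConformalRectangle) {F : ℂ → ℝ} (hF : Continuous F)
    (hR : PosCross[R, F, 0] ∨ ∃ c : ℝ, 0 < c ∧ ¬ PosCross[R, F, -c]) :
    ∃ η > 0, ∃ δ₁ > 0, ∀ δ : ℝ, 0 < δ → δ < δ₁ → ∀ g : Sym2 (Site 2) → ℝ,
      (∀ e ∈ InnerE[R.carrier, δ], |g e - F (medialPoint δ e)| < η) →
      (PosCfg[g] ∈ discreteCrossing R.carrier δ (R.arc 0) (R.arc 2) ↔ PosCross[R, F, 0]) := by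
  rcases hR with hpos | ⟨c, hc, hneg⟩
  · -- a positive crossing: it has a margin `c' > 0`, and survives discretisation
    obtain ⟨c', hc', hpos'⟩ := exists_lt_posCross hF hpos
    obtain ⟨δ₁, hδ₁, hd⟩ := discreteCrossing_of_posCross R hF hpos'
    refine ⟨c' / 2, by positivity, δ₁, hδ₁, fun δ hδ hδlt g hg => ⟨fun _ => hpos, fun _ => ?_⟩⟩
    refine hd δ hδ hδlt _ fun e he hFe => ⟨he.1, ?_⟩
    have := abs_lt.1 (hg e he)
    linarith
  · -- no crossing at level `-c`: neither side holds
    obtain ⟨δ₁, hδ₁, hd⟩ := posCrossing_of_discreteCrossing R hF (a := -c) (b := -c / 2)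
      (by linarith)
    refine ⟨c / 2, by positivity, δ₁, hδ₁, fun δ hδ hδlt g hg => ⟨fun hcross => ?_, fun h0 => ?_⟩⟩
    · refine absurd (hd δ hδ hδlt _ (fun e he hei => ?_) hcross) hneg
      have := abs_lt.1 (hg e hei)
      have := he.2
      linarith
    · obtain ⟨x, hx, y, hy, γ, hγ⟩ := h0
      exact absurd ⟨x, hx, y, hy, γ, fun t => ⟨(hγ t).1, by linarith [(hγ t).2]⟩⟩ hneg

end WhiteToColoured

end Summit.CriticalPhenomena.CardyFormulaZ2.Theorems
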